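import Literature.Probability.FitznerVanDerHofstad2017.Stage1Tails
import Literature.Probability.FitznerVanDerHofstad2017.Stage1Eval

/-!
# Rational evaluation of the closed-form tail majorant of the typed stage 1 (`Stage1Tails`)

Literature layer, sorry-free, fact-free: the companion of `Stage1Eval` for the tails stage.  `Stage1Tails` adds to the
tail-free cell-44 record `Data.inp` (`T″₀`) the `N ≥ 4` tails of notebook cells 41–43 and proves
`Data.inp ≤ inpFull ≤ inpMaj S S̄` (`inp_dom_inpMaj`), where `inpFull` reads the tail symbols as the series they denote
and `inpMaj S S̄` is the CLOSED-FORM MAJORANT at candidate inverses `S s` of `1 − B(s)²` and `S̄ s` of `1 − B̄(s)²`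
(Neumann certificates `(1 − B²) S = 1`, `S ≥ 0`).  Everything in `inpMaj` is a rational function of the cells; this file
makes that literal, so that a certificate can be EVALUATED by the kernel:

* `IngrQ`, `closedQ`, `pieceValQ`, `totalQ` — rational mirrors of `Ingr`, `Reading.closed`, `Piece.val`, `total`, with
  the cast lemmas `closedQ_cast`, `total_cast` (`Matrix.map (Rat.castHom ℝ)` commutes with the matrix algebra);
* `ingrQ E P s y`, `tailValQ`, `inpMajQ E P y s S S̄` — the ingredients, tail values and the majorant record of a
  rational data set `E : Stage1Cells.DataQ` at rational inverse candidates `S S̄ : Pt → Matrix (Fin 3) (Fin 3) ℚ`, and,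
  for a typed frame `D` MODELLED BY `E` (`Data.RatModel`, `Stage1Eval`), the cast lemmas `ingr_ratCast`,
  `tailVal_ratCast`, `inpMaj_ratCast : inpMaj (S·.map ↑) (S̄·.map ↑) D y.cast s = inpMajQ E D.P y s S S̄`;
* the transfer of kernel facts: `cert_cast` (a rational Neumann certificate is a real one), `inpMaj_dom_of_ratModel`
  and the full chain `inpFull_dom_of_ratModel : (… kernel-decidable hypotheses on E, S, S̄ …) → (inpFull D y.cast s).Dom N`
  — the record WITH TAILS of a modelled frame is dominated by a numeral record `N` as soon as the rational majorant
  record is, the two rational certificates hold, and the cells are `≥ 0` at the state.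

Nothing here is specific to `d = 11`; the instance at the certified tables is `MeanFieldD11Stage1TailsEval`.
Axioms: `propext`, `Classical.choice`, `Quot.sound` only.
-/

noncomputable section

namespace Literature.Probability.FitznerVanDerHofstad2017
namespace Stage1Tails

open scoped Matrix
open Finset

/-! ## Rational mirrors of the closed-form reading -/

section RatMirror

variable {n : Type*} [Fintype n] [DecidableEq n]

/-- rational mirror of `Kind.L`: `S`, `S²`, `1`. [folklore] -/
def Kind.LQ : Kind → Matrix n n ℚ → Matrix n n ℚ
  | .one, S => S
  | .lin, S => S * S
  | .delta, _ => 1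

/-- `Kind.LQ` casts to `Kind.L`. [folklore] -/
theorem Kind.LQ_map (k : Kind) (S : Matrix n n ℚ) :
    (k.LQ S).map (Rat.castHom ℝ) = k.L (S.map (Rat.castHom ℝ)) := by
  cases k
  · rfl
  · exact Matrix.map_mul
  · exact Matrix.map_one _ (map_zero _) (map_one _)

/-- rational ingredients (mirror of `Ingr`). [folklore] -/
structure IngrQ (n : Type*) [Fintype n] [DecidableEq n] where
  /-- left vectors -/
  u : USym → n → ℚ
  /-- middle matrices -/
  m : MSym → Matrix n n ℚ
  /-- right vectors -/
  w : WSym → n → ℚ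
  /-- `B` -/
  B : Matrix n n ℚ
  /-- `B̄` -/
  Bb : Matrix n n ℚ

/-- the real ingredients of rational ones. [folklore] -/
def IngrQ.cast (I : IngrQ n) : Ingr n where
  u t := (Rat.castHom ℝ) ∘ I.u t
  m t := (I.m t).map (Rat.castHom ℝ)
  w t := (Rat.castHom ℝ) ∘ I.w t
  B := I.B.map (Rat.castHom ℝ)
  Bb := I.Bb.map (Rat.castHom ℝ)

/-- rational mirror of `Reading.closed S S̄`. [folklore] -/
def closedQ (S Sb : Matrix n n ℚ) (drop : Bool) (ψ χ : Kind) (u : n → ℚ) (B : Matrix n n ℚ) (α : ℕ)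
    (M : Matrix n n ℚ) (Bb : Matrix n n ℚ) (β : ℕ) (w : n → ℚ) : ℚ :=
  u ⬝ᵥ ((B ^ α * (ψ.LQ S * M * χ.LQ Sb) * Bb ^ β) *ᵥ w) - if drop then u ⬝ᵥ ((B ^ α * M * Bb ^ β) *ᵥ w) else 0

omit [DecidableEq n] in
/-- `uᵀ X w` commutes with the cast. [folklore] -/
theorem cast_dotProduct_mulVec (u w : n → ℚ) (X : Matrix n n ℚ) :
    ((Rat.castHom ℝ) ∘ u) ⬝ᵥ (X.map (Rat.castHom ℝ) *ᵥ ((Rat.castHom ℝ) ∘ w)) = (((u ⬝ᵥ (X *ᵥ w)) : ℚ) : ℝ) := by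
  have h3 : X.map (Rat.castHom ℝ) *ᵥ ((Rat.castHom ℝ) ∘ w) = (Rat.castHom ℝ) ∘ (X *ᵥ w) := by
    funext i; exact (RingHom.map_mulVec _ _ _ i).symm
  rw [h3, ← RingHom.map_dotProduct]; rfl

/-- `closedQ` casts to `Reading.closed`. [folklore] -/
theorem closedQ_cast (S Sb : Matrix n n ℚ) (drop : Bool) (ψ χ : Kind) (u : n → ℚ) (B : Matrix n n ℚ) (α : ℕ)
    (M : Matrix n n ℚ) (Bb : Matrix n n ℚ) (β : ℕ) (w : n → ℚ) :
    Reading.closed (S.map (Rat.castHom ℝ)) (Sb.map (Rat.castHom ℝ)) drop ψ χ ((Rat.castHom ℝ) ∘ u)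
        (B.map (Rat.castHom ℝ)) α (M.map (Rat.castHom ℝ)) (Bb.map (Rat.castHom ℝ)) β ((Rat.castHom ℝ) ∘ w)
      = ((closedQ S Sb drop ψ χ u B α M Bb β w : ℚ) : ℝ) := by
  simp only [Reading.closed, closedQ, ← Kind.LQ_map, ← Matrix.map_pow, ← Matrix.map_mul, cast_dotProduct_mulVec]
  cases drop <;> simp

/-- rational mirror of `Piece.val` under the closed-form reading. [folklore] -/
def pieceValQ (S Sb : Matrix n n ℚ) (I : IngrQ n) (π : Piece) : ℚ :=
  (π.c : ℚ) * closedQ S Sb π.drop π.ψ π.χ (I.u π.u) I.B π.α (I.m π.M) I.Bb π.β (I.w π.w)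

/-- rational mirror of `total` under the closed-form reading. [folklore] -/
def totalQ (S Sb : Matrix n n ℚ) (I : IngrQ n) (l : List Piece) : ℚ := (l.map (pieceValQ S Sb I)).sum

/-- `pieceValQ` casts to `Piece.val`. [folklore] -/
theorem pieceVal_cast (S Sb : Matrix n n ℚ) (I : IngrQ n) (π : Piece) :
    π.val (Reading.closed (S.map (Rat.castHom ℝ)) (Sb.map (Rat.castHom ℝ))) I.cast = ((pieceValQ S Sb I π : ℚ) : ℝ) := by
  simp only [Piece.val, IngrQ.cast, pieceValQ, closedQ_cast]; push_cast; rfl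

/-- `totalQ` casts to `total`. [folklore] -/
theorem total_cast (S Sb : Matrix n n ℚ) (I : IngrQ n) :
    ∀ l : List Piece, total (Reading.closed (S.map (Rat.castHom ℝ)) (Sb.map (Rat.castHom ℝ))) I.cast l
      = ((totalQ S Sb I l : ℚ) : ℝ)
  | [] => by simp [totalQ]
  | π :: l => by
    rw [total_cons, total_cast S Sb I l, pieceVal_cast]; simp [totalQ]

/-- a rational Neumann certificate `(1 − B²) S = 1` is a real one. [folklore] -/
theorem cert_cast {B S : Matrix n n ℚ} (h : (1 - B * B) * S = 1) :
    (1 - B.map (Rat.castHom ℝ) * B.map (Rat.castHom ℝ)) * S.map (Rat.castHom ℝ) = 1 := by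
  have := congrArg (Rat.castHom ℝ).mapMatrix h
  simpa [map_mul, map_sub, map_one, RingHom.mapMatrix_apply] using this

omit [Fintype n] [DecidableEq n] in
/-- entrywise non-negativity passes through the cast. [folklore] -/
theorem nonneg_cast {S : Matrix n n ℚ} (h : ∀ i j, 0 ≤ S i j) : ∀ i j, 0 ≤ S.map (Rat.castHom ℝ) i j := by
  intro i j; simpa [Matrix.map_apply] using h i j

end RatMirror

/-! ## The rational majorant record of a rational data set, and the cast lemmas over a modelled frame -/

section Frame

open Stage1Cells NoGoFrame BetaMap

variable {ν : Type*}

/-- a typed vector of cells as a rational vector at `(s, y)` over the data `E`. [folklore] -/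
def evVQ (E : DataQ) (P : Params) (s : Pt) (y : StateQ) (v : Vec) : Fin 3 → ℚ := fun a => E.ev P s y (v a)

/-- a typed matrix of cells as a rational matrix at `(s, y)` over the data `E`. [folklore] -/
def evMQ (E : DataQ) (P : Params) (s : Pt) (y : StateQ) (Mx : Mat) : Matrix (Fin 3) (Fin 3) ℚ :=
  Matrix.of fun a b => E.ev P s y (Mx a b)

/-- the rational ingredients of cells 41–42 over the data `E` at `(s, y)` (mirror of `ingr`). [folklore] -/
def ingrQ (E : DataQ) (P : Params) (s : Pt) (y : StateQ) : IngrQ (Fin 3) where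
  u := fun
    | .PS => evVQ E P s y (PS P)
    | .Piota => evVQ E P s y (Piota P)
    | .hSAtNR => evVQ E P s y (hSAtNR P)
    | .hII => evVQ E P s y (hII P)
  m := fun
    | .AbarNR => evMQ E P s y (AiotabarNR P)
    | .one => 1
    | .C1 => evMQ E P s y (C1 P)
    | .C2 => evMQ E P s y (C2 P)
    | .C1BbBC2 => evMQ E P s y (C1BbarBC2 P)
    | .C2BbBC1 => evMQ E P s y (C2BbarBC1 P)
  w := fun
    | .PE => evVQ E P s y (PE P)
    | .H3PEAhE => evVQ E P s y (H3PEAhE P)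
    | .H2PEAhE => evVQ E P s y (H2PEAhE P)
  B := evMQ E P s y (B P)
  Bb := evMQ E P s y (Bbar P)

/-- the rational value of a cell-41/42 table under the closed-form reading at `S`, `S̄`. [folklore] -/
def tailValQ (E : DataQ) (P : Params) (y : StateQ) (s : Pt) (S Sb : Matrix (Fin 3) (Fin 3) ℚ)
    (l : List Piece) : ℚ :=
  totalQ S Sb (ingrQ E P s y) l

/-- THE RATIONAL MAJORANT RECORD: `Stage1Cells.DataQ.inpR` with the closed-form tails at `S s`, `S̄ s` added to the
twenty-two tail fields, literally as in `inpT`. [folklore] -/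
def inpMajQ (E : DataQ) (P : Params) (y : StateQ) (s : Pt) (S Sb : Pt → Matrix (Fin 3) (Fin 3) ℚ) : Inputs :=
  let tv : List Piece → ℝ := fun l => ((tailValQ E P y s (S s) (Sb s) l : ℚ) : ℝ)
  { E.inpR P y s with
    xiAbs := (E.inpR P y s).xiAbs + (tv Tail.xiOdd + tv Tail.xiEven)
    xiOdd := (E.inpR P y s).xiOdd + tv Tail.xiOdd
    xiEven := (E.inpR P y s).xiEven + tv Tail.xiEven
    xiEvenTail := (E.inpR P y s).xiEvenTail + tv Tail.xiEven
    xiOddTail := (E.inpR P y s).xiOddTail + tv Tail.xiOdd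
    xiDeltaAbs := (E.inpR P y s).xiDeltaAbs + (tv Tail.xiOddDelta + tv Tail.xiEvenDelta)
    xiOddDelta := (E.inpR P y s).xiOddDelta + tv Tail.xiOddDelta
    xiEvenDelta := (E.inpR P y s).xiEvenDelta + tv Tail.xiEvenDelta
    xiOddTailDelta := (E.inpR P y s).xiOddTailDelta + tv Tail.xiOddDelta
    xiEvenTailDelta := (E.inpR P y s).xiEvenTailDelta + tv Tail.xiEvenDelta
    xiIotaAbs := (E.inpR P y s).xiIotaAbs + (tv Tail.xiIotaOdd + tv Tail.xiIotaEven)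
    xiIotaOdd := (E.inpR P y s).xiIotaOdd + tv Tail.xiIotaOdd
    xiIotaEven := (E.inpR P y s).xiIotaEven + tv Tail.xiIotaEven
    xiIotaEvenTail := (E.inpR P y s).xiIotaEvenTail + tv Tail.xiIotaEven
    xiIotaDeltaEi := (E.inpR P y s).xiIotaDeltaEi + (tv Tail.xiIotaOddDeltaEi + tv Tail.xiIotaEvenDeltaEi)
    xiIotaOddDeltaEi := (E.inpR P y s).xiIotaOddDeltaEi + tv Tail.xiIotaOddDeltaEi
    xiIotaEvenDeltaEi := (E.inpR P y s).xiIotaEvenDeltaEi + tv Tail.xiIotaEvenDeltaEi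
    xiIotaEvenTailDeltaEi := (E.inpR P y s).xiIotaEvenTailDeltaEi + tv Tail.xiIotaEvenDeltaEi
    xiIotaDeltaZero := (E.inpR P y s).xiIotaDeltaZero
      + (tv Tail.xiIotaOddDeltaZero + tv Tail.xiIotaEvenDeltaZero)
    xiIotaOddDeltaZero := (E.inpR P y s).xiIotaOddDeltaZero + tv Tail.xiIotaOddDeltaZero
    xiIotaEvenDeltaZero := (E.inpR P y s).xiIotaEvenDeltaZero + tv Tail.xiIotaEvenDeltaZero
    xiIotaEvenTailDeltaZero := (E.inpR P y s).xiIotaEvenTailDeltaZero + tv Tail.xiIotaEvenDeltaZero }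

variable {D : Data ν} {E : DataQ} (h : D.RatModel E)
include h

/-- the ingredients of a modelled frame are the casts of the rational ones. [folklore] -/
theorem ingr_ratCast (s : Pt) (y : StateQ) : ingr D s y.cast = (ingrQ E D.P s y).cast := by
  have hv : ∀ v : Vec, evV D s y.cast v = (Rat.castHom ℝ) ∘ evVQ E D.P s y v :=
    fun v => funext fun a => Data.ev_ratCast h s y (v a)
  have hm : ∀ Mx : Mat, evM D s y.cast Mx = (evMQ E D.P s y Mx).map (Rat.castHom ℝ) :=
    fun Mx => Matrix.ext fun a b => Data.ev_ratCast h s y (Mx a b)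
  have h1 : (1 : Matrix (Fin 3) (Fin 3) ℝ) = (1 : Matrix (Fin 3) (Fin 3) ℚ).map (Rat.castHom ℝ) :=
    (Matrix.map_one _ (map_zero _) (map_one _)).symm
  show Ingr.mk _ _ _ _ _ = Ingr.mk _ _ _ _ _
  congr 1
  · funext t; cases t <;> exact hv _
  · funext t; cases t <;> first | exact hm _ | exact h1
  · funext t; cases t <;> exact hv _
  · exact hm _
  · exact hm _

/-- the tail value of a modelled frame under the cast closed-form reading is the cast of the rational one. [folklore] -/
theorem tailVal_ratCast (y : StateQ) (s : Pt) (S Sb : Matrix (Fin 3) (Fin 3) ℚ) (l : List Piece) :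
    tailVal (Reading.closed (S.map (Rat.castHom ℝ)) (Sb.map (Rat.castHom ℝ))) D y.cast s l
      = ((tailValQ E D.P y s S Sb l : ℚ) : ℝ) := by
  unfold tailVal tailValQ; rw [ingr_ratCast h]; exact total_cast S Sb _ l

/-- THE CAST LEMMA FOR THE MAJORANT RECORD. [folklore] -/
theorem inpMaj_ratCast (y : StateQ) (s : Pt) (S Sb : Pt → Matrix (Fin 3) (Fin 3) ℚ) :
    inpMaj (fun t => (S t).map (Rat.castHom ℝ)) (fun t => (Sb t).map (Rat.castHom ℝ)) D y.cast s
      = inpMajQ E D.P y s S Sb := by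
  simp only [inpMaj, inpT, inpMajQ, tailVal_ratCast h, Data.inp_ratCast h]

/-- kernel form: the majorant record of a modelled frame is dominated by `N` if the rational one is. [folklore] -/
theorem inpMaj_dom_of_ratModel {y : StateQ} {s : Pt} {S Sb : Pt → Matrix (Fin 3) (Fin 3) ℚ} {N : Inputs}
    (hN : (inpMajQ E D.P y s S Sb).Dom N) :
    (inpMaj (fun t => (S t).map (Rat.castHom ℝ)) (fun t => (Sb t).map (Rat.castHom ℝ)) D y.cast s).Dom N := by
  rw [inpMaj_ratCast h]; exact hN

/-- THE FULL CHAIN IN KERNEL FORM: the cell-44 record WITH ITS TAILS (series reading) of a modelled frame is dominated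
by a record `N` as soon as the cells are `≥ 0` at the state, the two RATIONAL Neumann certificates hold at the point,
and the rational majorant record is dominated by `N` — the last three being closed rational facts. [folklore] -/
theorem inpFull_dom_of_ratModel {y : StateQ} {s : Pt} {S Sb : Pt → Matrix (Fin 3) (Fin 3) ℚ} {N : Inputs}
    (hev : ∀ e, 0 ≤ D.ev s y.cast e)
    (hS0 : ∀ i j, 0 ≤ S s i j) (hS : (1 - (ingrQ E D.P s y).B * (ingrQ E D.P s y).B) * S s = 1)
    (hSb0 : ∀ i j, 0 ≤ Sb s i j) (hSb : (1 - (ingrQ E D.P s y).Bb * (ingrQ E D.P s y).Bb) * Sb s = 1)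
    (hN : (inpMajQ E D.P y s S Sb).Dom N) : (inpFull D y.cast s).Dom N := by
  have hB : (ingr D s y.cast).B = (ingrQ E D.P s y).B.map (Rat.castHom ℝ) := by rw [ingr_ratCast h]; rfl
  have hBb : (ingr D s y.cast).Bb = (ingrQ E D.P s y).Bb.map (Rat.castHom ℝ) := by rw [ingr_ratCast h]; rfl
  refine (inpFull_dom_inpMaj hev (S := fun t => (S t).map (Rat.castHom ℝ))
    (Sb := fun t => (Sb t).map (Rat.castHom ℝ)) (nonneg_cast hS0) ?_ (nonneg_cast hSb0) ?_).trans
    (inpMaj_dom_of_ratModel h hN)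
  · show (1 - _ * _) * (S s).map (Rat.castHom ℝ) = 1
    rw [hB]; exact cert_cast hS
  · show (1 - _ * _) * (Sb s).map (Rat.castHom ℝ) = 1
    rw [hBb]; exact cert_cast hSb

/-- … and so is the tail-free record `Data.inp` (which `Stage1Eval` also gives directly). [folklore] -/
theorem inp_dom_of_ratModel_tails {y : StateQ} {s : Pt} {S Sb : Pt → Matrix (Fin 3) (Fin 3) ℚ} {N : Inputs}
    (hev : ∀ e, 0 ≤ D.ev s y.cast e)
    (hS0 : ∀ i j, 0 ≤ S s i j) (hS : (1 - (ingrQ E D.P s y).B * (ingrQ E D.P s y).B) * S s = 1)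
    (hSb0 : ∀ i j, 0 ≤ Sb s i j) (hSb : (1 - (ingrQ E D.P s y).Bb * (ingrQ E D.P s y).Bb) * Sb s = 1)
    (hN : (inpMajQ E D.P y s S Sb).Dom N) : (D.inp y.cast s).Dom N :=
  (inp_dom_inpFull hev).trans (inpFull_dom_of_ratModel h hev hS0 hS hSb0 hSb hN)

end Frame

end Stage1Tails
end Literature.Probability.FitznerVanDerHofstad2017
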